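import Summits.QuantumFields.YangMills.Theorems.BalabanUVNodesN15DefectKernelPiece
import HarnessLib

/-!
# Route «BalabanUVNodes» (K4 «SpineRates»), node N15 = NE2, THE -a ∕ -b INTERFACE OF THE BACKGROUND LAYER, part 6: KING'S (4.33)–(4.34) FOR THE
# COVARIANCE — the uniform decay of `C^{(k)} = (Δ^{(k)} + aL⁻²Q*Q)⁻¹` EXPORTED, and the single-scale piece modulo Theorem 3.3 for the minimiser ONLY

Cell `pub-ymgap`, seat `pub-ymgap-dag-n15-a` (KNIT-BY-NAME, generation g2; HUMAN RULING D-0062; chair R424 venue; `bears_on: R4∕N15`).  Filed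
`--supports stmt-QuantumFields-19351` until the node stub `S_N15` of route «BalabanUVNodes» is an item.  THEOREMS ONLY; imports BY NAME, nothing
in the tree modified: part 5 `BalabanUVNodesN15DefectKernelPiece` (this seat: `hasMaj_idef_kingPiece`) and, through it, the template lineage's
`King1986.CovarianceRateTorus` (the constants `aminL`, `gam0L`, `kapU`, `CDelU`, `cB`, `kapCT`, `delta45`; `effLaplacian_entry_le_unif`, `blockTerm_entry_le`),
`King1986.CovarianceRate` (`covOp_decay` = King's (4.33)–(4.34) ⟹ uniform decay, `covOp_one`, `covOp_zero`), `King1986.EffectiveLaplacianSymbol` (`king433`),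
`King1986.UniformDecay` (`tdistT_isPseudoDist`, `tdistT_sumBound`), `B4Sect5Torus` (`weightedRowSum_le`, `weightedColSum_le`, `rate_mul_weightC_le`).

WHY.  Part 5 assembled King's single-scale piece (4.42) in binder (a)'s format with King's own p. 675 inputs as binders: Theorem 3.3's decay of the two
minimiser kernels AND one block majorant `N₀` (`‖N₀‖_ρ ≤ m₀`) of the two covariances `C^{(k)}`, `C^{(k+n)}`.  The second input is King's (4.33)–(4.34)
«uniform exponential decay of C_Ω^{(k)}(s)» (p. 674), which the tree PROVES inside `king_lemma45_torus` (as `covOp_decay` at `s = 1` and `s = 0` from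
`king433`, `effLaplacian_entry_le_unif`, `blockTerm_entry_le` and the Combes–Thomas row∕column sums of `B4Sect5Torus`) but does not export.  THIS FILE
exports it and discharges part 5's covariance binders BY NAME, leaving the single-scale piece modulo Theorem 3.3 for the minimiser `a_kG_kQ_k^*` only.
THAT decay IS in the tree UNCONDITIONALLY for Bałaban's volumes (unit tori `2L^m`): n18-b's `King1986.MinimizerTowerBridge.minimiser_kernel_decay`
(from lit-balaban's `B4Thm110ZeroTorus.thm110_zero_torus` = [Balaban1983RegularityDecay] (1.10)), restated on labels in
`King1986.MinimizerTwoSpacingDecay.minimiser_kernel_decay_labels` — but in the TOWER's physical distance `ε·T(x, z)` to the block of `b`; the remaining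
bridge to the binders `hdecH`∕`hdecH′` below is a DOMINANCE of the carrier's distance, `δ₀·d(blk_Ω b, blk_η x) ≤ δ₀^{B4}·ε·dist(x, B(b))`, of the same kind
as part 3's `hdom` — NOT built here (dag-ref-B READ #72, pin (i)); with it the piece below is by name throughout.

THE PRINT (King, CMP **102** (1986) p. 674, verbatim): *«Using the general results of Chap. 5 of [Ba 4], C_Ω^{(k)}(s) has uniform exponential decay if the
following conditions hold: (i) C_Ω^{(k)}(s)⁻¹ ≥ γ₀I, (4.33) (ii) |C_Ω^{(k)}(s)⁻¹(x, y)| ≤ C exp[−δ₀|x − y|]. (4.34)»* — a PROVED statement, kernel-reproduced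
in the tree (`King1986.CovarianceRate.covOp_decay`, header of `King1986.CovarianceRateTorus`).

CONTENTS.
* §1 **`kingCov_entry_le`**: for `L ≥ 2`, `k, n ≥ 1`, `a, m² > 0`, every torus `Π ℤ∕(LM_μ)` and all `x, y`:
  `|(Δ^{(k)} + aL⁻²Q*Q)⁻¹(x,y)| ≤ (2∕γ₀)·e^{−2δ₄₅·tdist(x,y)}` AND the same for `(Δ^{(k+n)} + aL⁻²Q*Q)⁻¹`, `γ₀ = gam0L d a L`, `2δ₄₅ = kapCT d a L` (the
  constants of `king_lemma45_torus`; the proof is that theorem's prelude + `covOp_decay` at the endpoints).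
* §2 `hasMaj_kingCov_one` ∕ `hasMaj_kingCov_zero`: the block majorant `nΩ·(2∕γ₀)·e^{−2δ_C d(y,y′)}` of both covariances between the sharp cube norms of any
  site assignment dominated as in part 3 (`δ_C·d ≤ δ₄₅·tdist`), and `wrow_kingCov` its weighted row sum `≤ nΩ(2∕γ₀)c_r` at `ρ` with `ρ + σ_r ≤ 2δ_C`.
* §3 **`hasMaj_idef_kingPiece_covFree`** = part 5's `hasMaj_idef_kingPiece` with `N₀`, `m₀` DISCHARGED (`m₀ = nΩ(2∕γ₀)c_r`): King's single-scale piece in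
  binder (a)'s format modulo Theorem 3.3 FOR THE MINIMISER ONLY (two decay binders), everything else by name.

HONEST FRAMING ∕ LIMITS.  King's scalar `A = 0` model; §1 is a re-export of a proved A = 0 estimate with the tree's explicit constants (periodic b.c., flat
block profile, `m² > 0`); the minimiser's Theorem 3.3 stays a binder; NOT Bałaban's covariant objects; NE2⁺ NOT PRINTED ∕ not proved; count-neutral
(typed 28∕28 · discharged unchanged); NOT a discharge of N15; one finite T⁴ at fixed ε — NOT infinite volume, NOT OS on ℝ⁴, NOT a mass gap, NOT Clay.
-/

noncomputable section

namespace Summit.QuantumFields.YangMills.BalabanUVNodes.N15.DefectKernel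

open Literature.MathematicalPhysics.QuantumFieldTheory.Balaban1983to89
open Literature.MathematicalPhysics.QuantumFieldTheory.Balaban1983to89.B11SectG (BlockNorm HasMaj RowSum)
open Literature.MathematicalPhysics.QuantumFieldTheory.Balaban1983to89.T4EtaRateDefect (idef)
open Literature.MathematicalPhysics.QuantumFieldTheory.Balaban1983to89.T4EtaRateCoeffDefect (pull fibre)
open Literature.MathematicalPhysics.QuantumFieldTheory.Balaban1983to89.B9SectDWeightedNeumann (WRow wrow_of_exp)
open Literature.MathematicalPhysics.QuantumFieldTheory.Balaban1983to89.B6RandomWalk (Triangle254)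
open Literature.MathematicalPhysics.QuantumFieldTheory.Balaban1983to89.B5Prop11Plancherel (Tor fine)
open Literature.MathematicalPhysics.QuantumFieldTheory.Balaban1983to89.QGQInverse (Coercive)
open Literature.MathematicalPhysics.QuantumFieldTheory.Balaban1983to89.B4Sect5Torus (IsPseudoDist SumBound weightC
  weightedRowSum_le weightedColSum_le rate_mul_weightC_le)
open Literature.MathematicalPhysics.QuantumFieldTheory.King1986 (aK covOp covOp_decay covOp_one covOp_zero wRow wCol
  prop38RateConst prop38PosConst lemma43Const exp_decay_mono)
open Literature.MathematicalPhysics.QuantumFieldTheory.King1986.Torus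

variable {d : ℕ}

/-! ## §1 King's (4.33)–(4.34): the uniform decay of both covariances, exported from `king_lemma45_torus`'s proof -/

/-- **THE UNIFORM DECAY OF KING'S COVARIANCES** `C^{(k)} = (Δ^{(k)} + aL⁻²Q*Q)⁻¹`, `C^{(k+n)}` on the torus `Π ℤ∕(LM_μ)` (`L ≥ 2`, `k, n ≥ 1`, `a, m² > 0`):
`|C(x,y)| ≤ (2∕γ₀)·e^{−2δ₄₅·tdist(x,y)}`, `γ₀ = gam0L d a L`, `2δ₄₅ = kapCT d a L` — conditions (4.33) (`king433`) and (4.34) (`effLaplacian_entry_le_unif`,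
`blockTerm_entry_le`) fed to the finite Combes–Thomas lemma (`covOp_decay`), exactly as in the tree's proof of Lemma 4.5. [cite: King1986, (4.33)–(4.34) p.674] -/
theorem kingCov_entry_le {a m2 : ℝ} (ha : 0 < a) (hm : 0 < m2) {L k n : ℕ} [NeZero L] (hL : 2 ≤ L) (hk : 1 ≤ k)
    (hn : 1 ≤ n) (M : Fin d → ℕ) [∀ μ, NeZero (M μ)] (x y : Tor (fine L M)) :
    |(effLaplacian (L ^ k) (fine L M) (aK a L k) (((L ^ k : ℕ) : ℝ) ^ 2) m2
        + (a * ((L : ℝ) ^ 2)⁻¹) • blockProj L M)⁻¹ x y|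
      ≤ 2 / gam0L d a L * Real.exp (-(2 * delta45 d a L * tdistT (fine L M) x y)) ∧
    |(effLaplacian (L ^ n * L ^ k) (fine L M) (aK a L (k + n)) (((L ^ n * L ^ k : ℕ) : ℝ) ^ 2) m2
        + (a * ((L : ℝ) ^ 2)⁻¹) • blockProj L M)⁻¹ x y|
      ≤ 2 / gam0L d a L * Real.exp (-(2 * delta45 d a L * tdistT (fine L M) x y)) := by
  -- notation (as in `king_lemma45_torus`)
  set Δ₁ := effLaplacian (L ^ k) (fine L M) (aK a L k) (((L ^ k : ℕ) : ℝ) ^ 2) m2 with hΔ₁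
  set Δ₀ := effLaplacian (L ^ n * L ^ k) (fine L M) (aK a L (k + n)) (((L ^ n * L ^ k : ℕ) : ℝ) ^ 2) m2
    with hΔ₀
  set B : Matrix (Tor (fine L M)) (Tor (fine L M)) ℝ := (a * ((L : ℝ) ^ 2)⁻¹) • blockProj L M with hB
  set ρd := tdistT (fine L M) with hρd
  set amin := aminL a L with hamin_def
  set γ₀ := gam0L d a L with hγ₀
  set κU := kapU d a amin with hκU
  set CU := CDelU d a amin with hCU
  set cb := cB d a L with hcb
  set κ' := kapCT d a L with hκ'
  set Kd := B4Sect5Proof.latticeConst d with hKd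
  -- positivity of the data
  have hL1 : 1 ≤ L := by omega
  have hamin : 0 < amin := aminL_pos ha hL
  obtain ⟨hak1, hak2⟩ := aminL_le_aK ha hL hk
  obtain ⟨hakn1, hakn2⟩ := aminL_le_aK ha hL (show 1 ≤ k + n by omega)
  have hγ₀pos : 0 < γ₀ := gam0L_pos ha hL
  obtain ⟨hκU0, hκU1⟩ := kapU_pos_le (d := d) ha hamin
  have hCU0 : 0 < CU := CDelU_pos ha hamin
  have hcb0 : 0 ≤ cb := cB_nonneg ha.le L
  obtain ⟨hκ'0, hκ'le⟩ := kapCT_pos_le (d := d) ha hL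
  have hκ'U : κ' ≤ κU / 4 := hκ'le
  have hKd : ∀ t : ℝ, 0 < t → 0 ≤ Kd t := latticeConst_profile_nonneg d
  -- (4.33): endpoint coercivity
  have h433 := king433 L M hL1 hamin ha hak1 hakn1 (L ^ k) (L ^ n * L ^ k) hm hm
  have h1 : Coercive (Δ₁ + B) γ₀ := h433.1
  have h0 : Coercive (Δ₀ + B) γ₀ := h433.2
  -- (4.34): pointwise decay of the inverse covariances' entries
  have hD1 : ∀ z w, |Δ₁ z w| ≤ CU * Real.exp (-(κU * ρd z w)) := fun z w =>
    effLaplacian_entry_le_unif ha hamin hak1 hak2 hm (L ^ k) (fine L M) z w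
  have hD0 : ∀ z w, |Δ₀ z w| ≤ CU * Real.exp (-(κU * ρd z w)) := fun z w =>
    effLaplacian_entry_le_unif ha hamin hakn1 hakn2 hm (L ^ n * L ^ k) (fine L M) z w
  have hDB : ∀ z w, |B z w| ≤ cb * Real.exp (-(κU * ρd z w)) := fun z w =>
    blockTerm_entry_le L M ha.le hκU0.le z w
  have hpd : IsPseudoDist ρd := tdistT_isPseudoDist (fine L M)
  have hSB : SumBound ρd Kd := tdistT_sumBound (fine L M)
  have hr1 : ∀ i, wRow Δ₁ ρd κ' i ≤ κ' * weightC Kd CU κU := fun i =>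
    weightedRowSum_le hpd.nonneg hSB Δ₁ hCU0.le hκU0 hκ'0.le hκ'U hD1 i
  have hr0 : ∀ i, wRow Δ₀ ρd κ' i ≤ κ' * weightC Kd CU κU := fun i =>
    weightedRowSum_le hpd.nonneg hSB Δ₀ hCU0.le hκU0 hκ'0.le hκ'U hD0 i
  have hrB : ∀ i, wRow B ρd κ' i ≤ κ' * weightC Kd cb κU := fun i =>
    weightedRowSum_le hpd.nonneg hSB B hcb0 hκU0 hκ'0.le hκ'U hDB i
  have hc1 : ∀ j, wCol Δ₁ ρd κ' j ≤ κ' * weightC Kd CU κU := fun j =>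
    weightedColSum_le hpd hSB Δ₁ hCU0.le hκU0 hκ'0.le hκ'U hD1 j
  have hc0 : ∀ j, wCol Δ₀ ρd κ' j ≤ κ' * weightC Kd CU κU := fun j =>
    weightedColSum_le hpd hSB Δ₀ hCU0.le hκU0 hκ'0.le hκ'U hD0 j
  have hcB : ∀ j, wCol B ρd κ' j ≤ κ' * weightC Kd cb κU := fun j =>
    weightedColSum_le hpd hSB B hcb0 hκU0 hκ'0.le hκ'U hDB j
  have hsum : κ' * weightC Kd CU κU + κ' * weightC Kd cb κU ≤ γ₀ / 2 := by
    have hlin : κ' * weightC Kd CU κU + κ' * weightC Kd cb κU = κ' * weightC Kd (CU + cb) κU := by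
      unfold weightC; ring
    rw [hlin]
    exact rate_mul_weightC_le hKd hγ₀pos (add_nonneg hCU0.le hcb0) hκU0
  have hγ : κ' * weightC Kd CU κU + κ' * weightC Kd cb κU < γ₀ := by linarith
  -- the Combes–Thomas decay of the interpolated covariance at the two endpoints
  have hdec : ∀ {s : ℝ}, 0 ≤ s → s ≤ 1 →
      |covOp Δ₁ Δ₀ B s x y| ≤ 2 / γ₀ * Real.exp (-(2 * delta45 d a L * ρd x y)) := by
    intro s hs0 hs1
    have h := covOp_decay Δ₁ Δ₀ B ρd hγ hκ'0.le h1 h0 hpd.symm hpd.zero hpd.triangle hr1 hr0 hrB hc1 hc0 hcB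
      hs0 hs1 x y
    have hinv : (γ₀ - (κ' * weightC Kd CU κU + κ' * weightC Kd cb κU))⁻¹ ≤ 2 / γ₀ := by
      rw [div_eq_mul_inv, show (2 : ℝ) * γ₀⁻¹ = (γ₀ / 2)⁻¹ by rw [inv_div]; ring]
      exact inv_anti₀ (by positivity) (by linarith)
    have hκ2 : 2 * delta45 d a L = κ' := by rw [hκ']; unfold delta45; ring
    rw [hκ2]
    exact h.trans (mul_le_mul_of_nonneg_right hinv (Real.exp_nonneg _))
  constructor
  · have h := hdec (s := 1) zero_le_one le_rfl
    rwa [covOp_one] at h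
  · have h := hdec (s := 0) le_rfl zero_le_one
    rwa [covOp_zero] at h

/-- `γ₀ > 0`, hence `2∕γ₀ ≥ 0`. [folklore] -/
theorem two_div_gam0L_nonneg {a : ℝ} (ha : 0 < a) {L : ℕ} (hL : 2 ≤ L) : 0 ≤ 2 / gam0L d a L :=
  div_nonneg zero_le_two (gam0L_pos ha hL).le

/-! ## §2 The covariances' block majorant `nΩ·(2∕γ₀)·e^{−2δ_C d}` under the dominance of part 3 -/

section Blocks

variable {a m2 : ℝ} {L k n : ℕ} [NeZero L] {g : B6.Geometry} [DecidableEq g.Site]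

/-- Block majorant of `C^{(k)}` between the sharp cube norms of a site assignment dominated by King's torus distance
(`δ_C·d(blk x, blk z) ≤ δ₄₅·tdist(x,z)`, as in part 3): `nΩ·(2∕γ₀)·e^{−2δ_C d(y,y′)}`. [cite: King1986, (4.33)–(4.34) p.674] -/
theorem hasMaj_kingCov_one (ha : 0 < a) (hm : 0 < m2) (hL : 2 ≤ L) (hk : 1 ≤ k) (hn : 1 ≤ n) (M : Fin d → ℕ)
    [∀ μ, NeZero (M μ)] (blkΩ : Tor (fine L M) → g.Site) {nΩ : ℕ} (hnΩ : ∀ y', (fibre blkΩ y').card ≤ nΩ) {δC : ℝ}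
    (hdom : ∀ x z, δC * g.dist (blkΩ x) (blkΩ z) ≤ delta45 d a L * tdistT (fine L M) x z) :
    HasMaj (BlockNorm.ofBlocks g blkΩ) (BlockNorm.ofBlocks g blkΩ)
      (Matrix.mulVecLin (effLaplacian (L ^ k) (fine L M) (aK a L k) (((L ^ k : ℕ) : ℝ) ^ 2) m2
        + (a * ((L : ℝ) ^ 2)⁻¹) • blockProj L M)⁻¹)
      (fun y y' => nΩ * (2 / gam0L d a L * Real.exp (-(2 * δC * g.dist y y')))) :=
  hasMaj_ofBlocks_of_entry_le blkΩ blkΩ (κ := fun y y' => 2 / gam0L d a L * Real.exp (-(2 * δC * g.dist y y')))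
    (fun _ _ => mul_nonneg (two_div_gam0L_nonneg ha hL) (Real.exp_nonneg _)) hnΩ fun x z => by
      rw [mulVecLin_single_apply]
      refine ((kingCov_entry_le ha hm hL hk hn M x z).1).trans
        (mul_le_mul_of_nonneg_left (Real.exp_le_exp.mpr ?_) (two_div_gam0L_nonneg ha hL))
      have := hdom x z
      linarith

/-- The same for `C^{(k+n)}`. [cite: King1986, (4.33)–(4.34) p.674] -/
theorem hasMaj_kingCov_zero (ha : 0 < a) (hm : 0 < m2) (hL : 2 ≤ L) (hk : 1 ≤ k) (hn : 1 ≤ n) (M : Fin d → ℕ)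
    [∀ μ, NeZero (M μ)] (blkΩ : Tor (fine L M) → g.Site) {nΩ : ℕ} (hnΩ : ∀ y', (fibre blkΩ y').card ≤ nΩ) {δC : ℝ}
    (hdom : ∀ x z, δC * g.dist (blkΩ x) (blkΩ z) ≤ delta45 d a L * tdistT (fine L M) x z) :
    HasMaj (BlockNorm.ofBlocks g blkΩ) (BlockNorm.ofBlocks g blkΩ)
      (Matrix.mulVecLin (effLaplacian (L ^ n * L ^ k) (fine L M) (aK a L (k + n)) (((L ^ n * L ^ k : ℕ) : ℝ) ^ 2) m2
        + (a * ((L : ℝ) ^ 2)⁻¹) • blockProj L M)⁻¹)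
      (fun y y' => nΩ * (2 / gam0L d a L * Real.exp (-(2 * δC * g.dist y y')))) :=
  hasMaj_ofBlocks_of_entry_le blkΩ blkΩ (κ := fun y y' => 2 / gam0L d a L * Real.exp (-(2 * δC * g.dist y y')))
    (fun _ _ => mul_nonneg (two_div_gam0L_nonneg ha hL) (Real.exp_nonneg _)) hnΩ fun x z => by
      rw [mulVecLin_single_apply]
      refine ((kingCov_entry_le ha hm hL hk hn M x z).2).trans
        (mul_le_mul_of_nonneg_left (Real.exp_le_exp.mpr ?_) (two_div_gam0L_nonneg ha hL))
      have := hdom x z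
      linarith

omit [NeZero L] [DecidableEq g.Site] in
/-- … and its weighted row-sum norm from (2.61): `‖nΩ(2∕γ₀)e^{−2δ_C d}‖_ρ ≤ nΩ(2∕γ₀)c_r` for `ρ + σ_r ≤ 2δ_C`. [cite: Balaban1984PropagatorsII, Lemma 2.1 (2.61) p.234] -/
theorem wrow_kingCov (ha : 0 < a) (hL : 2 ≤ L) {nΩ : ℕ} {δC ρ σr cr : ℝ} (hdist : ∀ y y' : g.Site, 0 ≤ g.dist y y')
    (hrow : RowSum g σr cr) (hρ : ρ + σr ≤ 2 * δC) :
    WRow g ρ (fun y y' => nΩ * (2 / gam0L d a L * Real.exp (-(2 * δC * g.dist y y')))) (nΩ * (2 / gam0L d a L) * cr) := by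
  have h := wrow_of_exp (ρ := ρ) (θ := nΩ * (2 / gam0L d a L)) (δ := 2 * δC) hdist hrow
    (mul_nonneg (Nat.cast_nonneg _) (two_div_gam0L_nonneg ha hL)) hρ
  exact h.mono fun y y' => le_of_eq (by ring)

end Blocks

/-! ## §3 The single-scale piece modulo Theorem 3.3 for the minimiser only -/

/-- **KING'S SINGLE-SCALE PIECE IN BINDER (a)'s FORMAT, COVARIANCE INPUTS DISCHARGED** — part 5's `hasMaj_idef_kingPiece` with the block majorant of
both covariances supplied by §2 (`N₀ = nΩ(2∕γ₀)e^{−2δ_C d}`, `m₀ = nΩ(2∕γ₀)c_r`): the defect of `(a_kG_kQ_k^*)·C^{(k)}·(Q_kG_k)` against its `η′`-twin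
through King's pairing has the block majorant of part 5 with `m₀ = nΩ(2∕γ₀)c_r`, MODULO ONLY Theorem 3.3's decay of the two minimiser kernels (binders
`hdecH`, `hdecH′` — [Ba 4]) and the carrier∕site-assignment binders. [cite: King1986, (4.42)–(4.43) p.675; (4.33)–(4.34) p.674; Prop. 3.8 (3.71) p.664; Lemma 4.5 (4.38) p.674] -/
theorem hasMaj_idef_kingPiece_covFree (hd : 0 < d) {L : ℕ} [NeZero L] (hLodd : Odd L) (hL : 2 ≤ L) {k n : ℕ}
    (hk : 1 ≤ k) (hn : 1 ≤ n) (M : Fin d → ℕ) [hM : ∀ μ, NeZero (M μ)] {a m2 : ℝ} (ha : 0 < a) (hm : 0 < m2)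
    {γ : ℝ} (hγ0 : 0 ≤ γ) (hγ1 : γ ≤ 1)
    {g : B6.Geometry} [DecidableEq g.Site] (htri : Triangle254 g) (hdist : ∀ y y' : g.Site, 0 ≤ g.dist y y')
    (hsymm : ∀ y y' : g.Site, g.dist y y' = g.dist y' y) {σr cr : ℝ} (hσr : 0 ≤ σr) (hrow : RowSum g σr cr)
    (blkΩ : Tor (fine L M) → g.Site) {nΩ : ℕ} (hnΩ : ∀ y', (fibre blkΩ y').card ≤ nΩ)
    (blkη : Tor (fine (L ^ k) (fine L M)) → g.Site) {nη : ℕ} (hnη : ∀ y', (fibre blkη y').card ≤ nη)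
    (pr : Tor (fine (L ^ n * L ^ k) (fine L M)) → Tor (fine (L ^ k) (fine L M)))
    (hpr : ∀ x' μ, (pr x' μ).val = (x' μ).val / L ^ n)
    (H : (Tor (fine L M) → ℝ) →ₗ[ℝ] (Tor (fine (L ^ k) (fine L M)) → ℝ))
    (hH : ∀ φ, H φ = minimiser (L ^ k) (fine L M) (aK a L k) (((L ^ k : ℕ) : ℝ) ^ 2) m2 φ)
    (H' : (Tor (fine L M) → ℝ) →ₗ[ℝ] (Tor (fine (L ^ n * L ^ k) (fine L M)) → ℝ))
    (hH' : ∀ φ, H' φ = minimiser (L ^ n * L ^ k) (fine L M) (aK a L (k + n)) (((L ^ n * L ^ k : ℕ) : ℝ) ^ 2) m2 φ)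
    {w : ℝ} (hw0 : 0 ≤ w) (K : (Tor (fine (L ^ k) (fine L M)) → ℝ) →ₗ[ℝ] (Tor (fine L M) → ℝ))
    (hK : ∀ x b, K (Pi.single x 1) b = w * H (Pi.single b 1) x)
    (K' : (Tor (fine (L ^ n * L ^ k) (fine L M)) → ℝ) →ₗ[ℝ] (Tor (fine L M) → ℝ))
    (hK' : ∀ x' b, K' (Pi.single x' 1) b = w / ((L : ℝ) ^ n) ^ d * H' (Pi.single b 1) x')
    {c₀ δ₀ : ℝ} (hc₀ : 0 ≤ c₀)
    (hdecH : ∀ (b : Tor (fine L M)) (x : Tor (fine (L ^ k) (fine L M))),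
      |H (Pi.single b 1) x| ≤ c₀ * Real.exp (-(δ₀ * g.dist (blkΩ b) (blkη x))))
    (hdecH' : ∀ (b : Tor (fine L M)) (x' : Tor (fine (L ^ n * L ^ k) (fine L M))),
      |H' (Pi.single b 1) x'| ≤ c₀ * Real.exp (-(δ₀ * g.dist (blkΩ b) (blkη (pr x')))))
    {ρ : ℝ} (hρ : 0 ≤ ρ) {δC : ℝ}
    (hdom : ∀ x z, δC * g.dist (blkΩ x) (blkΩ z) ≤ delta45 d a L * tdistT (fine L M) x z)
    (hρ₁ : ρ + σr ≤ δ₀ / 2) (hρ₂ : ρ + σr ≤ δC) :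
    HasMaj (BlockNorm.ofBlocks g blkη) (BlockNorm.ofBlocks g (blkη ∘ pr))
      (idef (pull pr) (pull pr)
        (H' ∘ₗ (Matrix.mulVecLin (effLaplacian (L ^ n * L ^ k) (fine L M) (aK a L (k + n))
            (((L ^ n * L ^ k : ℕ) : ℝ) ^ 2) m2 + (a * ((L : ℝ) ^ 2)⁻¹) • blockProj L M)⁻¹ ∘ₗ K'))
        (H ∘ₗ (Matrix.mulVecLin (effLaplacian (L ^ k) (fine L M) (aK a L k) (((L ^ k : ℕ) : ℝ) ^ 2) m2
            + (a * ((L : ℝ) ^ 2)⁻¹) • blockProj L M)⁻¹ ∘ₗ K)))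
      (fun y y' =>
        (nΩ * c₀ * cr *
            (nΩ * (2 / gam0L d a L) * cr *
                (nη * w * Real.sqrt ((prop38RateConst a a (lemma43Const a L k n) ((Real.pi ^ 2 / 4) ^ d) d γ
                  + prop38PosConst a ((Real.pi ^ 2 / 4) ^ d) d γ) * ((L ^ k : ℕ) : ℝ) ^ (-γ) * (2 * c₀)))
              + nΩ * (K45 d a L * ((L : ℝ) ^ k)⁻¹) * cr * (nη * w * c₀))
          + nΩ * Real.sqrt ((prop38RateConst a a (lemma43Const a L k n) ((Real.pi ^ 2 / 4) ^ d) d γ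
                + prop38PosConst a ((Real.pi ^ 2 / 4) ^ d) d γ) * ((L ^ k : ℕ) : ℝ) ^ (-γ) * (2 * c₀)) * cr *
            (nΩ * (2 / gam0L d a L) * cr * (nη * w * c₀))) *
        Real.exp (-(ρ * g.dist y y'))) := by
  have hδC : ρ + σr ≤ 2 * δC := by linarith
  exact hasMaj_idef_kingPiece hd hLodd hL hk hn M ha hm hγ0 hγ1 htri hdist hsymm hσr hrow blkΩ hnΩ blkη hnη pr hpr
    H hH H' hH' hw0 K hK K' hK' hc₀ hdecH hdecH'
    (fun y y' => mul_nonneg (Nat.cast_nonneg _) (mul_nonneg (two_div_gam0L_nonneg ha hL) (Real.exp_nonneg _)))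
    hρ (wrow_kingCov ha hL hdist hrow hδC) (hasMaj_kingCov_one ha hm hL hk hn M blkΩ hnΩ hdom)
    (hasMaj_kingCov_zero ha hm hL hk hn M blkΩ hnΩ hdom) hdom hρ₁ hρ₂

end Summit.QuantumFields.YangMills.BalabanUVNodes.N15.DefectKernel
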